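import Summits.CriticalPhenomena.CardyFormulaZ2.Theses.CardyBoundaryCoulombGas
import Literature.Probability.LatticeModels.RowStatePlanar
import Literature.Probability.Percolation.LatticeSymmetry

/-!
# Powers of the planar `⋆`-chain `planarTransfer S` as normalised counts over bond sequences

Shared counting infrastructure for the line `two-cluster-rate-is-stationary-gap` of the crux
`CardyBoundaryCoulombGas.StripClusterRates` (stmt-CriticalPhenomena-13878).

The stochastic matrix `planarTransfer S` (`RowStatePlanar.lean`) of one row step of bond
percolation at `p = 1/2` acting on planar connectivity patterns is, BY DEFINITION
(`PercolationRowTransfer`), the normalised count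
`T p q = #{(O, H) ∈ univ ×ˢ (hEdges S).powerset : planarRowStep O H p = q} / (2^|S| · 2^|hEdges S|)`.
Iterating, the `m`-th power is the normalised count over ADMISSIBLE SEQUENCES
`seq : Fin m → Finset S × Finset S`, `seq t ∈ univ ×ˢ (hEdges S).powerset`
(`Fintype.piFinset`), of the deterministic iterate
`(List.ofFn seq).foldl (fun r OH => planarRowStep OH.1 OH.2 r) p` (time `0` first):

* `s1_planarTransfer_apply`, `s1_planarTransfer_mulVec` — one step (entry / observable form);
* `s1_pow_planarTransfer_mulVec` — `(T^m *ᵥ g) p = (∑_{seq} g (iterate seq p)) / (2^|S| 2^|hEdges S|)^m`;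
* `s1_pow_planarTransfer_apply` — `(T^m) p q = #{seq : iterate seq p = q} / (2^|S| 2^|hEdges S|)^m`;
* small companions: `s1_planarRowStep_inter_hEdges` (labels outside `hEdges S` are inert),
  `s1_planarTransfer_nonneg`, `s1_planarTransfer_pos_iff`, `s1_sum_piFinset_succ` (peeling the
  first letter of a word: `Fin.cons`), `s1_card_filter_bounds` (a sum supported on a filter, with
  values in `[lo, hi]` there, is squeezed between `#filter · lo` and `#filter · hi`);
* BLOCK STRUCTURE of `T` in "is some site joined to `⋆`" (MARKED / UNMARKED patterns): a row step
  never attaches `⋆` to a pattern in which `⋆` is isolated (`s1_rowStep_not_joinedToStar`: "`⋆`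
  isolated" is the lattice condition `rel ≤ ker Sum.isRight`, preserved by `vertRel O ≤ id` and by
  joins of two sites), hence `T u q = 0` for `u` unmarked and `q` marked
  (`s1_planarTransfer_eq_zero_of_not_joinedToStar`); the wired pattern is marked
  (`s1_joinedToStar_wired`).

Everything is elementary bookkeeping (induction on `m`, `pow_succ'`, `Matrix.mulVec_mulVec`,
`List.ofFn_succ`, `Finset.sum_fiberwise'`). Sources: Bondesan–Jacobsen–Saleur, Nucl. Phys. B 867
(2013) §2 (connectivity transfer matrix); Blöte–Nightingale (1982); folklore.
-/

noncomputable section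

namespace Summit.CriticalPhenomena.CardyFormulaZ2.Cruxes.StripClusterRates.TwoClusterRateIsStationaryGap

open Filter Topology
open scoped BigOperators Classical Matrix
open Literature.Probability.Percolation Literature.Probability.LatticeModels

/-! ## One step -/

/-- Horizontal labels outside `hEdges S` are inert: `x ∉ hEdges S` labels no edge
(`hEdgeRel x = ⊥`), so a row step only depends on `H ∩ hEdges S`. [folklore] -/
theorem s1_planarRowStep_inter_hEdges (S : Finset ℤ) (O H : Finset S) (p : PlanarRowState S) :
    planarRowStep O (H ∩ hEdges S) p = planarRowStep O H p := by
  apply Subtype.ext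
  apply RowState.ext
  show horizRel (H ∩ hEdges S) (vertRel O p.1.rel) = horizRel H (vertRel O p.1.rel)
  unfold horizRel
  congr 1
  apply le_antisymm
  · exact Finset.sup_mono Finset.inter_subset_left
  · refine Finset.sup_le fun x hx => ?_
    by_cases h : (x : ℤ) + 1 ∈ S
    · exact Finset.le_sup (f := hEdgeRel) (Finset.mem_inter.2 ⟨hx, (mem_hEdges x).2 h⟩)
    · rw [hEdgeRel_of_not_mem x h]
      exact bot_le

/-- A planar row step equals a planar state iff the underlying row steps agree. [folklore] -/
theorem s1_planarRowStep_eq_iff (S : Finset ℤ) (O H : Finset S) (p q : PlanarRowState S) :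
    planarRowStep O H p = q ↔ rowStep O H p.1 = q.1 := by
  constructor
  · rintro rfl
    rfl
  · intro h
    exact Subtype.ext h

/-- **Entries of the planar transfer matrix are normalised counts** (the definition of
`PercolationRowTransfer`, transported to planar states):
`T p q = #{(O,H) : planarRowStep O H p = q} / (2^|S| 2^|hEdges S|)`. [folklore] -/
theorem s1_planarTransfer_apply (S : Finset ℤ) (p q : PlanarRowState S) :
    planarTransfer S p q =
      ((((Finset.univ : Finset (Finset S)) ×ˢ (hEdges S).powerset).filter
          fun OH => planarRowStep OH.1 OH.2 p = q).card : ℝ) /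
        ((2 : ℝ) ^ S.card * 2 ^ (hEdges S).card) := by
  unfold planarTransfer PercolationRowTransfer
  congr 3
  exact Finset.filter_congr fun OH _ => (s1_planarRowStep_eq_iff S OH.1 OH.2 p q).symm

/-- Entries of the planar transfer matrix are nonnegative. [folklore] -/
theorem s1_planarTransfer_nonneg (S : Finset ℤ) (p q : PlanarRowState S) :
    0 ≤ planarTransfer S p q :=
  percolationRowTransfer_nonneg S p.1 q.1

/-- **Support of the planar transfer matrix**: `T p q > 0` iff some admissible bond configuration
`(O, H)`, `H ⊆ hEdges S`, steps `p` to `q`. [folklore] -/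
theorem s1_planarTransfer_pos_iff (S : Finset ℤ) (p q : PlanarRowState S) :
    0 < planarTransfer S p q ↔ ∃ O H : Finset S, H ⊆ hEdges S ∧ planarRowStep O H p = q := by
  rw [s1_planarTransfer_apply]
  have hN : (0 : ℝ) < (2 : ℝ) ^ S.card * 2 ^ (hEdges S).card := by positivity
  rw [div_pos_iff_of_pos_right hN, Nat.cast_pos, Finset.card_pos]
  constructor
  · rintro ⟨OH, hOH⟩
    rw [Finset.mem_filter, Finset.mem_product, Finset.mem_powerset] at hOH
    exact ⟨OH.1, OH.2, hOH.1.2, hOH.2⟩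
  · rintro ⟨O, H, hH, hq⟩
    refine ⟨(O, H), ?_⟩
    rw [Finset.mem_filter, Finset.mem_product, Finset.mem_powerset]
    exact ⟨⟨Finset.mem_univ _, hH⟩, hq⟩

/-- A step that happens has probability at least `1 / (2^|S| 2^|hEdges S|)`. [folklore] -/
theorem s1_inv_le_planarTransfer (S : Finset ℤ) (O H : Finset S) (hH : H ⊆ hEdges S)
    (p : PlanarRowState S) :
    ((2 : ℝ) ^ S.card * 2 ^ (hEdges S).card)⁻¹ ≤ planarTransfer S p (planarRowStep O H p) := by
  rw [s1_planarTransfer_apply, inv_eq_one_div]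
  have hN : (0 : ℝ) < (2 : ℝ) ^ S.card * 2 ^ (hEdges S).card := by positivity
  refine div_le_div_of_nonneg_right ?_ hN.le
  have h1 : (1 : ℝ) = ((1 : ℕ) : ℝ) := by norm_num
  rw [h1, Nat.cast_le, Nat.succ_le_iff, Finset.card_pos]
  refine ⟨(O, H), ?_⟩
  rw [Finset.mem_filter, Finset.mem_product, Finset.mem_powerset]
  exact ⟨⟨Finset.mem_univ _, hH⟩, rfl⟩

/-- **One step, observable form**: `(T *ᵥ g) p` is the average of `g` over the `2^|S| 2^|hEdges S|`
equally likely bond configurations of one row. [folklore] -/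
theorem s1_planarTransfer_mulVec (S : Finset ℤ) (g : PlanarRowState S → ℝ) (p : PlanarRowState S) :
    (planarTransfer S *ᵥ g) p =
      (∑ OH ∈ (Finset.univ : Finset (Finset S)) ×ˢ (hEdges S).powerset,
          g (planarRowStep OH.1 OH.2 p)) / ((2 : ℝ) ^ S.card * 2 ^ (hEdges S).card) := by
  simp only [Matrix.mulVec, dotProduct]
  simp_rw [s1_planarTransfer_apply, div_mul_eq_mul_div, ← Finset.sum_div]
  congr 1
  rw [← Finset.sum_fiberwise' ((Finset.univ : Finset (Finset S)) ×ˢ (hEdges S).powerset)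
    (fun OH => planarRowStep OH.1 OH.2 p) g]
  refine Finset.sum_congr rfl fun q _ => ?_
  rw [Finset.sum_const, nsmul_eq_mul]

/-! ## Words of bond configurations: peeling the first letter -/

/-- Summing over words of length `m + 1` with letters in `s` = summing over (first letter, tail)
(`Fin.cons`). [folklore] -/
theorem s1_sum_piFinset_succ {β M : Type*} [AddCommMonoid M] (s : Finset β) (m : ℕ)
    (G : (Fin (m + 1) → β) → M) :
    ∑ seq ∈ Fintype.piFinset (fun _ : Fin (m + 1) => s), G seq =
      ∑ a ∈ s, ∑ seq ∈ Fintype.piFinset (fun _ : Fin m => s), G (Fin.cons a seq) := by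
  rw [← Finset.sum_product (s := s) (t := Fintype.piFinset fun _ : Fin m => s)
    (f := fun x => G (Fin.cons x.1 x.2))]
  symm
  refine Finset.sum_nbij' (fun x => Fin.cons x.1 x.2) (fun seq => (seq 0, Fin.tail seq)) ?_ ?_ ?_ ?_ ?_
  · intro x hx
    rw [Finset.mem_product, Fintype.mem_piFinset] at hx
    rw [Fintype.mem_piFinset]
    refine Fin.cases ?_ ?_
    · simpa using hx.1
    · intro i
      simpa using hx.2 i
  · intro seq hseq
    rw [Fintype.mem_piFinset] at hseq
    rw [Finset.mem_product, Fintype.mem_piFinset]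
    exact ⟨hseq 0, fun i => hseq i.succ⟩
  · intro x _
    simp only [Fin.cons_zero, Fin.tail_cons]
  · intro seq _
    exact Fin.cons_self_tail seq
  · intro x _
    rfl

/-- The iterate of a word of length `m + 1` is the iterate of its tail from the first step.
[folklore] -/
theorem s1_foldl_ofFn_cons {S : Finset ℤ} {m : ℕ} (OH : Finset S × Finset S)
    (seq : Fin m → Finset S × Finset S) (p : PlanarRowState S) :
    (List.ofFn (Fin.cons OH seq : Fin (m + 1) → Finset S × Finset S)).foldl
        (fun r OH => planarRowStep OH.1 OH.2 r) p =
      (List.ofFn seq).foldl (fun r OH => planarRowStep OH.1 OH.2 r) (planarRowStep OH.1 OH.2 p) := by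
  rw [List.ofFn_succ, List.foldl_cons]
  simp only [Fin.cons_zero, Fin.cons_succ]

/-! ## `m` steps -/

/-- **`m` steps, observable form**: `(T^m *ᵥ g) p` is the average of `g (iterate seq p)` over the
admissible words `seq` of length `m` (time `0` first). [folklore] -/
theorem s1_pow_planarTransfer_mulVec : ∀ (S : Finset ℤ) (m : ℕ) (g : PlanarRowState S → ℝ)
    (p : PlanarRowState S),
    (planarTransfer S ^ m *ᵥ g) p =
      (∑ seq ∈ Fintype.piFinset (fun _ : Fin m =>
          (Finset.univ : Finset (Finset S)) ×ˢ (hEdges S).powerset),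
        g ((List.ofFn seq).foldl (fun r OH => planarRowStep OH.1 OH.2 r) p)) /
        ((2 : ℝ) ^ S.card * 2 ^ (hEdges S).card) ^ m := by
  intro S m g p
  induction m generalizing p with
  | zero =>
    have h0 : (Fintype.piFinset fun _ : Fin 0 =>
        (Finset.univ : Finset (Finset S)) ×ˢ (hEdges S).powerset) = {fun i => i.elim0} := by
      ext seq
      simp only [Finset.mem_singleton, Fintype.mem_piFinset, IsEmpty.forall_iff, true_iff]
      exact Subsingleton.elim _ _
    rw [pow_zero, pow_zero, div_one, Matrix.one_mulVec, h0, Finset.sum_singleton, List.ofFn_zero,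
      List.foldl_nil]
  | succ m ih =>
    rw [pow_succ', ← Matrix.mulVec_mulVec, s1_planarTransfer_mulVec]
    simp_rw [ih]
    rw [← Finset.sum_div, div_div, ← pow_succ, s1_sum_piFinset_succ]
    refine congrArg (· / _) ?_
    refine Finset.sum_congr rfl fun OH _ => Finset.sum_congr rfl fun seq _ => ?_
    rw [s1_foldl_ofFn_cons]

/-- **`m` steps, entry form**: `(T^m) p q = #{admissible seq of length m : iterate seq p = q} /
(2^|S| 2^|hEdges S|)^m`. [folklore] -/
theorem s1_pow_planarTransfer_apply (S : Finset ℤ) (m : ℕ) (p q : PlanarRowState S) :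
    (planarTransfer S ^ m) p q =
      (((Fintype.piFinset fun _ : Fin m =>
            (Finset.univ : Finset (Finset S)) ×ˢ (hEdges S).powerset).filter
          fun seq => (List.ofFn seq).foldl (fun r OH => planarRowStep OH.1 OH.2 r) p = q).card : ℝ) /
        ((2 : ℝ) ^ S.card * 2 ^ (hEdges S).card) ^ m := by
  have h : (planarTransfer S ^ m) p q = (planarTransfer S ^ m *ᵥ Pi.single q 1) p := by
    rw [Matrix.mulVec_single_one]
    rfl
  rw [h, s1_pow_planarTransfer_mulVec, Finset.natCast_card_filter]
  congr 1
  refine Finset.sum_congr rfl fun seq _ => ?_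
  rw [Pi.single_apply]

/-- **Positivity of a power entry from a word**: an admissible word stepping `p` to `q` makes
`(T^m) p q > 0`. [folklore] -/
theorem s1_pow_planarTransfer_pos_of_foldl (S : Finset ℤ) (m : ℕ) (p q : PlanarRowState S)
    (seq : Fin m → Finset S × Finset S) (hseq : ∀ t, (seq t).2 ⊆ hEdges S)
    (hq : (List.ofFn seq).foldl (fun r OH => planarRowStep OH.1 OH.2 r) p = q) :
    0 < (planarTransfer S ^ m) p q := by
  rw [s1_pow_planarTransfer_apply]
  have hN : (0 : ℝ) < ((2 : ℝ) ^ S.card * 2 ^ (hEdges S).card) ^ m := by positivity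
  rw [div_pos_iff_of_pos_right hN, Nat.cast_pos, Finset.card_pos]
  refine ⟨seq, ?_⟩
  rw [Finset.mem_filter, Fintype.mem_piFinset]
  refine ⟨fun t => ?_, hq⟩
  rw [Finset.mem_product, Finset.mem_powerset]
  exact ⟨Finset.mem_univ _, hseq t⟩

/-- Powers of the planar transfer matrix are entrywise nonnegative. [folklore] -/
theorem s1_pow_planarTransfer_nonneg (S : Finset ℤ) (m : ℕ) (p q : PlanarRowState S) :
    0 ≤ (planarTransfer S ^ m) p q :=
  Matrix.pow_apply_nonneg (fun a b => s1_planarTransfer_nonneg S a b) m p q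

/-! ## A counting squeeze -/

/-- **Counting squeeze.** If `f` vanishes on `A` outside the filter `P` and takes values in
`[lo, hi]` on it, then `#(A.filter P) · lo ≤ ∑_A f ≤ #(A.filter P) · hi`. [folklore] -/
theorem s1_card_filter_bounds {α : Type*} {A : Finset α} {f : α → ℝ} {s : ℝ}
    (hs : ∑ a ∈ A, f a = s) (P : α → Prop) [DecidablePred P] (lo hi : ℝ)
    (hzero : ∀ a ∈ A, ¬ P a → f a = 0)
    (hlo : ∀ a ∈ A, P a → lo ≤ f a) (hhi : ∀ a ∈ A, P a → f a ≤ hi) :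
    ((A.filter P).card : ℝ) * lo ≤ s ∧ s ≤ ((A.filter P).card : ℝ) * hi := by
  subst hs
  rw [← Finset.sum_filter_of_ne (p := P) (fun a ha hne => by
    by_contra h
    exact hne (hzero a ha h))]
  constructor
  · rw [← nsmul_eq_mul]
    exact Finset.card_nsmul_le_sum _ _ _ fun a ha =>
      hlo a (Finset.mem_filter.1 ha).1 (Finset.mem_filter.1 ha).2
  · rw [← nsmul_eq_mul]
    exact Finset.sum_le_card_nsmul _ _ _ fun a ha =>
      hhi a (Finset.mem_filter.1 ha).1 (Finset.mem_filter.1 ha).2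

/-! ## Block structure: `⋆` is never re-attached -/

/-- "No site is joined to `⋆`" is the lattice condition `rel ≤ ker Sum.isRight` (the two-block
partition sites / `⋆`). [folklore] -/
theorem s1_not_joinedToStar_iff_le_ker {S : Finset ℤ} (π : RowState S) :
    (∀ x, ¬ π.JoinedToStar x) ↔ π.rel ≤ Setoid.ker (Sum.isRight : RowPoint S → Bool) := by
  constructor
  · intro h
    rw [Setoid.le_def]
    rintro (x | ⟨⟩) (y | ⟨⟩) hab
    · exact Setoid.ker_def.2 rfl
    · exact absurd hab (h x)
    · exact absurd (π.rel.symm' hab) (h y)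
    · exact Setoid.ker_def.2 rfl
  · intro h x hx
    exact absurd (Setoid.ker_def.1 (h hx)) Bool.false_ne_true

/-- **Row steps never attach `⋆` to an unmarked pattern**: the vertical layer only cuts
(`vertRel_le`) and the horizontal layer only joins sites with sites. [folklore] -/
theorem s1_rowStep_not_joinedToStar {S : Finset ℤ} (O H : Finset S) (π : RowState S)
    (hπ : ∀ x, ¬ π.JoinedToStar x) : ∀ x, ¬ (rowStep O H π).JoinedToStar x := by
  rw [s1_not_joinedToStar_iff_le_ker] at hπ ⊢
  show vertRel O π.rel ⊔ H.sup hEdgeRel ≤ _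
  refine sup_le ((vertRel_le O π.rel).trans hπ) (Finset.sup_le fun x _ => ?_)
  by_cases h : (x : ℤ) + 1 ∈ S
  · rw [hEdgeRel_of_mem x h, joinTwo_le_iff]
    exact Setoid.ker_def.2 rfl
  · rw [hEdgeRel_of_not_mem x h]
    exact bot_le

/-- Planar version of `s1_rowStep_not_joinedToStar`. [folklore] -/
theorem s1_planarRowStep_not_joinedToStar {S : Finset ℤ} (O H : Finset S) (p : PlanarRowState S)
    (hp : ∀ x, ¬ p.1.JoinedToStar x) : ∀ x, ¬ (planarRowStep O H p).1.JoinedToStar x :=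
  s1_rowStep_not_joinedToStar O H p.1 hp

/-- **Block structure of the planar transfer matrix**: no transition from an unmarked pattern to
a marked one. [folklore] -/
theorem s1_planarTransfer_eq_zero_of_not_joinedToStar {S : Finset ℤ} (u q : PlanarRowState S)
    (hu : ∀ x, ¬ u.1.JoinedToStar x) (hq : ∃ x, q.1.JoinedToStar x) : planarTransfer S u q = 0 := by
  by_contra hne
  have hpos : 0 < planarTransfer S u q :=
    lt_of_le_of_ne (s1_planarTransfer_nonneg S u q) (Ne.symm hne)
  obtain ⟨O, H, -, hOH⟩ := (s1_planarTransfer_pos_iff S u q).1 hpos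
  obtain ⟨x, hx⟩ := hq
  rw [← hOH] at hx
  exact s1_planarRowStep_not_joinedToStar O H u hu x hx

/-- The wired pattern is marked (at any of its sites). [folklore] -/
theorem s1_joinedToStar_wired {S : Finset ℤ} (x : S) : (PlanarRowState.wired S).1.JoinedToStar x :=
  trivial

end Summit.CriticalPhenomena.CardyFormulaZ2.Cruxes.StripClusterRates.TwoClusterRateIsStationaryGap

end
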